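import Summits.AtomisticToContinuum.Crystallization.Theses.TwoCentreKissingKernel
import Summits.AtomisticToContinuum.Crystallization.Theorems.TwoCentreKissingKernelBondToShells
import Summits.AtomisticToContinuum.Crystallization.Theorems.TwoCentreKissingKernelKernelGlue

/-!
# Line `birth` — birth-certificate skeleton (BC3) for the crux `LocalClosePacking`
(stmt-AtomisticToContinuum-12076, route `TwoCentreKissingKernel`, rank 0 = route target, auto-crux)

THE CRUX (local close packing of Lennard-Jones ground states in `ℝ³`): there is a bond length
`a > 0` such that along every sequence of Lennard-Jones ground states `x N : Fin N → ℝ³` the fraction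
of particles `i` whose rescaled soft first shell `{a⁻¹(x_j − x_i) : j ≠ i, dist x_i x_j ≤ (1+10⁻³)a}`
is NOT `1/10`-close after a linear isometry to the FCC or the HCP kissing pattern tends to `0`.

THE LINE (the route's own two-layer plan for its target, typed as three registered stubs and the
two landed glue theorems; nothing new is claimed here):

  `LocalClosePacking ⇐ BondOrderTwelve → GapFreeShellRigidity → LocalClosePacking`   (`BondToShells`,
  PROVED: `Theorems.bondToShells_proof`, Theorems/TwoCentreKissingKernelBondToShells.lean, 263 lines,
  tree @ 71fc88d526e0 — rescale by `1/a`, the kernel at `η = 10⁻³` about every particle whose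
  `4a`-neighbourhood is bond-good, each bond-bad particle spoils `≤ 1000` good ones by the volume
  packing bound, squeeze), and
  `GapFreeShellRigidity ⇐ SoftTwoCentreFourCommon → RobustTangencyBound → GapFreeShellRigidity`
  (`KernelGlue`, PROVED: `Theorems.kernelGlue_proof`, Theorems/TwoCentreKissingKernelKernelGlue.lean,
  144 lines, tree @ 8a75990e2b58 — the soft two-centre lemma applied to `x` and each of its twelve
  soft neighbours gives every shell point `≥ 4` soft-tangent partners in the shell, hence `≥ 48`
  ordered soft-tangent pairs, and effective 24-tangency rigidity concludes).

So the three OPEN leaves under the target are the stubs: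

* `stub_bondOrderTwelve` (= route item stmt-AtomisticToContinuum-12079 `BondOrderTwelve`, crux rank 4,
  difficulty open-problem; THE HARDEST) — LJ BOND ORDER, first shell only: `∃ a > 0`, in LJ ground
  states all but `o(N)` particles are `(1−10⁻³)a`-separated from every other particle and have
  EXACTLY twelve others within `(1+10⁻³)a`.
* `stub_softTwoCentreFourCommon` (= route item stmt-AtomisticToContinuum-12081, support, difficulty L;
  its `η = 0` section is the crux `TwoCentreFourCommon` = Flatley–Theil Conjecture 2.2,
  `Theorems.twoCentreFourCommon_of_softTwoCentreFourCommon`) — SOFT TWO-CENTRE LEMMA at tolerance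
  `η ∈ [0, 10⁻³]`: in a `(1−η)`-separated `Z ⊂ ℝ³`, two distinct points within `1+η` of each other,
  each with exactly twelve other points within `1+η`, have `≥ 4` common such neighbours.  Landed
  attack surface: `Theorems.softTwoCentreFourCommon_of_finite` (≤ 24-point configurations),
  `softTwoCentreFourCommon_iff_dimer`, `softTwoCentreFourCommon_of_no_nineteen` ("19 balls never
  touch a soft unit dimer", a compact certificate target of dimension ≤ 57).
* `stub_robustTangencyBound` (= route item stmt-AtomisticToContinuum-12082, support, difficulty L) —
  EFFECTIVE 24-TANGENCY RIGIDITY: for `η ∈ [0, 10⁻³]`, twelve points with norms in `[1−η, 1+η]`,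
  pairwise `≥ 1−η`, carrying `≥ 48` ordered pairs at distance `≤ 1+η`, are `1/10`-close after a
  linear isometry to `fccKissingPattern` or `hcpKissingPattern` (Flatley–Tarasov–Taylor–Theil 2013
  made effective; large landed certificate programme `Theorems/TwoCentreKissingKernelRobustTangencyBound*.lean`).

* `composition : <stub₁-sig> → <stub₂-sig> → <stub₃-sig> → (the crux, unfolded)` — the kernel-checked
  composition, NO sorry (axioms propext / Classical.choice / Quot.sound): the three hypotheses are the registered
  signatures verbatim; each is by `Iff.rfl` the corresponding route item, and
  `bondToShells_proof hB (kernelGlue_proof hS hR)` is the crux.  (Stated with the crux UNFOLDED,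
  `localClosePacking_iff`, so that exactly one theorem of this file — `LocalClosePacking_of` — concludes the
  route decl by name, with no hypotheses: the skeleton checker requires the concluding theorem's hypotheses to
  be registered obligations by name or to be discharged inside the proof.)
* `LocalClosePacking_of : LocalClosePacking` — the crux concluded BY NAME, the three declared stubs discharged
  inside the proof (`sorry` lives only in `stub_*`; `LocalClosePacking_of` reaches `sorryAx` only through them).

Disproof used: none exists for this crux (`ledger crux ls stmt-AtomisticToContinuum-12076`: no
workfiles, 2026-08-17; no `Theorems/LocalClosePacking/Negative/`).  Negatives index
(`ledger negatives --problem AtomisticToContinuum`, 20 statements): none equal or trivially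
equivalent to a stub; the two nearest (stmt-15929 `GappedShellCensus.ShellCensus`, torn icosahedron
at tolerance `1/50` with the Hales gap; stmt-4146 `BrittleMieDescent.EffectiveLocalHales` at `1/100`)
live at tolerances `≥ 17×` the kernel's `10⁻³`, where the icosahedral edge (`1.0515`) and the
decahedral closure (`η⋆ ≈ 0.0067`, barrier `DecahedralSoftShell`) are excluded.

Conventions: stub signatures are ONE LINE, FULLY QUALIFIED, character-for-character the bodies of
the route decls `BondOrderTwelve` / `SoftTwoCentreFourCommon` / `RobustTangencyBound` (so a proof of a
stub is a proof of the item and conversely — one `--supports` line either way); no `open` is needed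
to restate them.
-/

namespace Summit.AtomisticToContinuum.Crystallization.Cruxes.LocalClosePacking.Birth

open Summit.AtomisticToContinuum.Crystallization.Theses.TwoCentreKissingKernel
open Summit.AtomisticToContinuum.Crystallization.Theorems

/-! ## Registered stubs (sorries live ONLY here) -/

/-- **STUB 1 — Lennard-Jones bond order, first shell only** (= route item
stmt-AtomisticToContinuum-12079 `BondOrderTwelve`; size: open problem; THE HARDEST STUB).  There is
a bond length `a > 0` (expected `a ≈ 0.971`, the bulk LJ nearest-neighbour distance) such that for
every sequence of Lennard-Jones ground states in `ℝ³` the fraction of particles `i` failing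
[`(1−10⁻³)a ≤ dist xᵢ xⱼ` for all `j ≠ i`, and exactly twelve `j ≠ i` with `dist xᵢ xⱼ ≤ (1+10⁻³)a`]
tends to `0`.  Intended mechanism (route header): a soft kissing bound caps the soft coordination at
`12` (Tammes-13 margin `57.14° < 59.86°`); energy accounting `E(N) ≤ N e_hcp + O(N^(2/3))` with a
bond / elastic / `r⁻⁶`-tail split forces twelve bonds and strain `< 10⁻³` away from `o(N)` defects;
uniform separation of ground states is the PROVED `LennardJonesMinimalDistance_holds`.  Why it might
fail: a positive fraction of bulk LJ particles not twelve-coordinated within `0.1 %` (LJ₁₃ is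
icosahedral; decahedral motifs close at `0.67 %` strain), or persistent bulk strain `≥ 10⁻³`; no
energy → coordination inequality without a three-body term is known in 3-D
(barriers `IcosahedralClusters`, `TetrahedralFrustration`). -/
theorem stub_bondOrderTwelve : ∃ a : ℝ, 0 < a ∧ ∀ x : (N : ℕ) → (Fin N → EuclideanSpace ℝ (Fin 3)), (∀ N, Literature.MathematicalPhysics.StatisticalMechanics.IsGroundState Literature.MathematicalPhysics.StatisticalMechanics.lennardJones (x N)) → Filter.Tendsto (fun N : ℕ => (Nat.card {i : Fin N // ¬ ((∀ j : Fin N, j ≠ i → (1 - 1 / 1000) * a ≤ dist (x N i) (x N j)) ∧ Nat.card {j : Fin N // j ≠ i ∧ dist (x N i) (x N j) ≤ (1 + 1 / 1000) * a} = 12)} : ℝ) / N) Filter.atTop (nhds 0) := by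
  sorry

/-- **STUB 2 — soft two-centre lemma, tolerance `η ∈ [0, 10⁻³]`** (= route item
stmt-AtomisticToContinuum-12081 `SoftTwoCentreFourCommon`; size L; its `η = 0` section is
Flatley–Theil's Conjecture 2.2 = the route's crux `TwoCentreFourCommon`, arXiv:1407.0692 §2.1).  In a
`(1−η)`-separated `Z ⊂ ℝ³`, two distinct points `z, z'` with `dist z z' ≤ 1+η`, each with exactly
twelve other points of `Z` within `1+η`, have at least four common such neighbours — equivalently
(`Theorems.softTwoCentreFourCommon_iff_dimer`) at most `18` further points of `Z` lie within `1+η`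
of `z` or `z'`.  Attack: the landed finite reductions `softTwoCentreFourCommon_of_finite` (≤ 24
points) / `softTwoCentreFourCommon_of_no_nineteen` (no 19 pairwise `(1−η)`-separated points on a soft
unit dimer; compact configuration space of dimension ≤ 57) + an interval branch-and-bound or a
coupled two-sphere SDP certificate with slack.  Why it might fail: unproved in print even at
`η = 0`; the one-sphere `L12` cap code only forces `≥ 3`; coupled `c = 3` searches reach
min-distance ratio `0.973–0.978` and 19-on-a-dimer searches `≈ 0.990` (kit j016614) — a
configuration above `0.999` would refute it. -/
theorem stub_softTwoCentreFourCommon : ∀ η : ℝ, 0 ≤ η → η ≤ 1 / 1000 → ∀ Z : Set (EuclideanSpace ℝ (Fin 3)), (∀ x ∈ Z, ∀ y ∈ Z, x ≠ y → 1 - η ≤ dist x y) → ∀ z ∈ Z, ∀ z' ∈ Z, z ≠ z' → dist z z' ≤ 1 + η → {w ∈ Z | w ≠ z ∧ dist w z ≤ 1 + η}.ncard = 12 → {w ∈ Z | w ≠ z' ∧ dist w z' ≤ 1 + η}.ncard = 12 → 4 ≤ {w ∈ Z | w ≠ z ∧ w ≠ z' ∧ dist w z ≤ 1 + η ∧ dist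 w z' ≤ 1 + η}.ncard := by
  sorry

/-- **STUB 3 — effective 24-tangency rigidity, tolerance `η ∈ [0, 10⁻³]`** (= route item
stmt-AtomisticToContinuum-12082 `RobustTangencyBound`; size L; Flatley–Tarasov–Taylor–Theil 2013,
doi:10.1016/j.cam.2013.03.036 = FT Thm 3.5, made effective).  Twelve points with norms in
`[1−η, 1+η]`, pairwise `≥ 1−η`, carrying `≥ 48` ordered pairs at distance `≤ 1+η` (i.e. `≥ 24` soft
tangencies, the maximum) are `1/10`-close after a linear isometry to the FCC or the HCP kissing
pattern.  Attack: the landed certificate programme `Theorems/TwoCentreKissingKernelRobustTangencyBound*.lean`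
(contact-graph case tree: vertex stars, pentagon / rhombus systems, `Hfan`/`Hstar`/`Hzig` certificates,
`shellCloseTo_fcc_of_labelled` / `…_hcp_…` as the final glue).  Why it might fail: the centred
(anti)cuboctahedron contact framework has exactly one infinitesimal flex (rigidity rank 32 of 33),
so 24-contact shells drift `O(√η) ≈ 0.03–0.05` at `η = 10⁻³`; a 25-contact shell or a 24-contact
shell `1/10`-far from both patterns below `10⁻³` kills the constant (the torn icosahedron of the
negatives index needs tolerance `≈ 1.77 %`, the decahedral shell `≈ 0.67 %`). -/
theorem stub_robustTangencyBound : ∀ η : ℝ, 0 ≤ η → η ≤ 1 / 1000 → ∀ T : Finset (EuclideanSpace ℝ (Fin 3)), T.card = 12 → (∀ y ∈ T, 1 - η ≤ ‖y‖ ∧ ‖y‖ ≤ 1 + η) → (∀ y ∈ T, ∀ y' ∈ T, y ≠ y' → 1 - η ≤ dist y y') → 48 ≤ Nat.card {q : ↥T × ↥T // q.1 ≠ q.2 ∧ dist (q.1 : EuclideanSpace ℝ (Fin 3)) q.2 ≤ 1 + η} → Literature.Geometry.DiscreteGeometry.ShellCloseTo (1 / 10) T Literature.Geometry.DiscreteGeometry.fccKissingPattern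 ∨ Literature.Geometry.DiscreteGeometry.ShellCloseTo (1 / 10) T Literature.Geometry.DiscreteGeometry.hcpKissingPattern := by
  sorry

/-! ## The stubs are the route items (definitional unfolding) -/

/-- Stub 1 is literally the route item `BondOrderTwelve`. -/
theorem bondOrderTwelve_iff :
    BondOrderTwelve ↔ ∃ a : ℝ, 0 < a ∧ ∀ x : (N : ℕ) → (Fin N → EuclideanSpace ℝ (Fin 3)), (∀ N, Literature.MathematicalPhysics.StatisticalMechanics.IsGroundState Literature.MathematicalPhysics.StatisticalMechanics.lennardJones (x N)) → Filter.Tendsto (fun N : ℕ => (Nat.card {i : Fin N // ¬ ((∀ j : Fin N, j ≠ i → (1 - 1 / 1000) * a ≤ dist (x N i) (x N j)) ∧ Nat.card {j : Fin N // j ≠ i ∧ dist (x N i) (x N j) ≤ (1 + 1 / 1000) * a} = 12)} : ℝ) / N) Filter.atTop (nhds 0) :=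
  Iff.rfl

/-- Stub 2 is literally the route item `SoftTwoCentreFourCommon`. -/
theorem softTwoCentreFourCommon_iff :
    SoftTwoCentreFourCommon ↔ ∀ η : ℝ, 0 ≤ η → η ≤ 1 / 1000 → ∀ Z : Set (EuclideanSpace ℝ (Fin 3)), (∀ x ∈ Z, ∀ y ∈ Z, x ≠ y → 1 - η ≤ dist x y) → ∀ z ∈ Z, ∀ z' ∈ Z, z ≠ z' → dist z z' ≤ 1 + η → {w ∈ Z | w ≠ z ∧ dist w z ≤ 1 + η}.ncard = 12 → {w ∈ Z | w ≠ z' ∧ dist w z' ≤ 1 + η}.ncard = 12 → 4 ≤ {w ∈ Z | w ≠ z ∧ w ≠ z' ∧ dist w z ≤ 1 + η ∧ dist w z' ≤ 1 + η}.ncard :=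
  Iff.rfl

/-- Stub 3 is literally the route item `RobustTangencyBound`. -/
theorem robustTangencyBound_iff :
    RobustTangencyBound ↔ ∀ η : ℝ, 0 ≤ η → η ≤ 1 / 1000 → ∀ T : Finset (EuclideanSpace ℝ (Fin 3)), T.card = 12 → (∀ y ∈ T, 1 - η ≤ ‖y‖ ∧ ‖y‖ ≤ 1 + η) → (∀ y ∈ T, ∀ y' ∈ T, y ≠ y' → 1 - η ≤ dist y y') → 48 ≤ Nat.card {q : ↥T × ↥T // q.1 ≠ q.2 ∧ dist (q.1 : EuclideanSpace ℝ (Fin 3)) q.2 ≤ 1 + η} → Literature.Geometry.DiscreteGeometry.ShellCloseTo (1 / 10) T Literature.Geometry.DiscreteGeometry.fccKissingPattern ∨ Literature.Geometry.DiscreteGeometry.ShellCloseTo (1 / 10) T Literature.Geometry.DiscreteGeometry.hcpKissingPattern :=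
  Iff.rfl

/-! ## The crux in unfolded form -/

/-- The crux `LocalClosePacking` is, by definitional unfolding, the displayed statement (used to state
`composition` with the crux unfolded and to fold it back in `LocalClosePacking_of`). -/
theorem localClosePacking_iff :
    LocalClosePacking ↔
      ∃ a : ℝ, 0 < a ∧ ∀ x : (N : ℕ) → (Fin N → EuclideanSpace ℝ (Fin 3)), (∀ N, Literature.MathematicalPhysics.StatisticalMechanics.IsGroundState Literature.MathematicalPhysics.StatisticalMechanics.lennardJones (x N)) → Filter.Tendsto (fun N : ℕ => (Nat.card {i : Fin N // ¬ ∃ T : Finset (EuclideanSpace ℝ (Fin 3)), (↑T : Set (EuclideanSpace ℝ (Fin 3))) = (fun j : Fin N => a⁻¹ • (x N j - x N i)) '' {j : Fin N | j ≠ i ∧ dist (x N i) (x N j) ≤ (1 + 1 / 1000) * a} ∧ (Literature.Geometry.DiscreteGeometry.ShellCloseTo (1 / 10) T Literature.Geometry.DiscreteGeometry.fccKissingPattern ∨ Literature.Geometry.DiscreteGeometry.ShellCloseTo (1 / 10) T Literature.Geometry.DiscreteGeometry.hcpKissingPattern)} : ℝ) / N) Filter.atTop (nhds 0) :=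
  Iff.rfl

/-! ## Composition -/

/-- **The composition** (`<stub₁-sig> → <stub₂-sig> → <stub₃-sig> → (the crux, unfolded)`; the hypotheses
are the registered signatures verbatim, as `LocalClosePacking_of` checks by feeding the declared stubs; no
`sorry`).  The soft two-centre lemma and effective 24-tangency rigidity give the gap-free kernel
`GapFreeShellRigidity` by the landed `kernelGlue_proof`; bond order and the kernel give local close packing by
the landed `bondToShells_proof`. -/
theorem composition :
    (∃ a : ℝ, 0 < a ∧ ∀ x : (N : ℕ) → (Fin N → EuclideanSpace ℝ (Fin 3)), (∀ N, Literature.MathematicalPhysics.StatisticalMechanics.IsGroundState Literature.MathematicalPhysics.StatisticalMechanics.lennardJones (x N)) → Filter.Tendsto (fun N : ℕ => (Nat.card {i : Fin N // ¬ ((∀ j : Fin N, j ≠ i → (1 - 1 / 1000) * a ≤ dist (x N i) (x N j)) ∧ Nat.card {j : Fin N // j ≠ i ∧ dist (x N i) (x N j) ≤ (1 + 1 / 1000) * a} = 12)} : ℝ) / N) Filter.atTop (nhds 0)) →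
    (∀ η : ℝ, 0 ≤ η → η ≤ 1 / 1000 → ∀ Z : Set (EuclideanSpace ℝ (Fin 3)), (∀ x ∈ Z, ∀ y ∈ Z, x ≠ y → 1 - η ≤ dist x y) → ∀ z ∈ Z, ∀ z' ∈ Z, z ≠ z' → dist z z' ≤ 1 + η → {w ∈ Z | w ≠ z ∧ dist w z ≤ 1 + η}.ncard = 12 → {w ∈ Z | w ≠ z' ∧ dist w z' ≤ 1 + η}.ncard = 12 → 4 ≤ {w ∈ Z | w ≠ z ∧ w ≠ z' ∧ dist w z ≤ 1 + η ∧ dist w z' ≤ 1 + η}.ncard) →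
    (∀ η : ℝ, 0 ≤ η → η ≤ 1 / 1000 → ∀ T : Finset (EuclideanSpace ℝ (Fin 3)), T.card = 12 → (∀ y ∈ T, 1 - η ≤ ‖y‖ ∧ ‖y‖ ≤ 1 + η) → (∀ y ∈ T, ∀ y' ∈ T, y ≠ y' → 1 - η ≤ dist y y') → 48 ≤ Nat.card {q : ↥T × ↥T // q.1 ≠ q.2 ∧ dist (q.1 : EuclideanSpace ℝ (Fin 3)) q.2 ≤ 1 + η} → Literature.Geometry.DiscreteGeometry.ShellCloseTo (1 / 10) T Literature.Geometry.DiscreteGeometry.fccKissingPattern ∨ Literature.Geometry.DiscreteGeometry.ShellCloseTo (1 / 10) T Literature.Geometry.DiscreteGeometry.hcpKissingPattern) →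
      ∃ a : ℝ, 0 < a ∧ ∀ x : (N : ℕ) → (Fin N → EuclideanSpace ℝ (Fin 3)), (∀ N, Literature.MathematicalPhysics.StatisticalMechanics.IsGroundState Literature.MathematicalPhysics.StatisticalMechanics.lennardJones (x N)) → Filter.Tendsto (fun N : ℕ => (Nat.card {i : Fin N // ¬ ∃ T : Finset (EuclideanSpace ℝ (Fin 3)), (↑T : Set (EuclideanSpace ℝ (Fin 3))) = (fun j : Fin N => a⁻¹ • (x N j - x N i)) '' {j : Fin N | j ≠ i ∧ dist (x N i) (x N j) ≤ (1 + 1 / 1000) * a} ∧ (Literature.Geometry.DiscreteGeometry.ShellCloseTo (1 / 10) T Literature.Geometry.DiscreteGeometry.fccKissingPattern ∨ Literature.Geometry.DiscreteGeometry.ShellCloseTo (1 / 10) T Literature.Geometry.DiscreteGeometry.hcpKissingPattern)} : ℝ) / N) Filter.atTop (nhds 0) := by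
  intro hB hS hR
  -- the three hypotheses are the route items, by definitional unfolding
  have hB' : BondOrderTwelve := bondOrderTwelve_iff.2 hB
  have hS' : SoftTwoCentreFourCommon := softTwoCentreFourCommon_iff.2 hS
  have hR' : RobustTangencyBound := robustTangencyBound_iff.2 hR
  -- the gap-free kernel from the soft two-centre lemma + effective rigidity (landed `KernelGlue`, stmt-12083)
  have hK : GapFreeShellRigidity := kernelGlue_proof hS' hR'
  -- local close packing from bond order + the kernel (landed `BondToShells`, stmt-12084)
  have hL : LocalClosePacking := bondToShells_proof hB' hK
  exact localClosePacking_iff.1 hL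

/-- **The crux from the line, concluded BY NAME** (type literally the route decl
`TwoCentreKissingKernel.LocalClosePacking`; no hypotheses — the three declared stubs are discharged inside the
proof, `sorry` lives only in `stub_*`). -/
theorem LocalClosePacking_of : LocalClosePacking :=
  localClosePacking_iff.2 (composition stub_bondOrderTwelve stub_softTwoCentreFourCommon stub_robustTangencyBound)

end Summit.AtomisticToContinuum.Crystallization.Cruxes.LocalClosePacking.Birth
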